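import Summits.BirchSwinnertonDyer.Rank1Residual.Additive.RamifiedSevenGenusSemilocalKernel
import HarnessLib

set_option autoImplicit false

/-!
# `𝒞₇` genus road (crux `EllipticUnitValueSevenOfGZK`, K7r), row K2C-12 = (B2′) KUMMER NON-VANISHING, File L5a:
# THE Λ-SIDE OF THE GENUS RESIDUE — a twisted `Υ`-sum of `θ^𝔞` with unit character-weight is NOT divisible by `7` in `𝓤`

Cell bsd-cm, seat bsd-cm-k-ty1 g31; memo `Cruxes/EllipticUnitValueSevenOfGZK/K2C12KummerNonvanishing_g31.md` §1 (m1)/(f2) first half,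
§3 L5; pen D1069/D1073.  For a genus datum `dat` over a frame `F` with `GenusResidueNonzeroShape dat` (`e_{η₁}θ^𝔞 ∉ 7·𝓤^{η₁}`),
a finite family of torsion elements `υᵢ ∈ Υ` with `η₁(υᵢ) = tᵢ`, exponents `jᵢ ∈ ℕ` and integer weights `kᵢ ∈ ℕ` such that the
CHARACTER-WEIGHT `Σᵢ kᵢ tᵢ ∈ ℤ₇` is a UNIT, the twisted sum `x′ := Σᵢ kᵢ • υᵢ·((1+T)^{jᵢ} • (48 • θraw)) ∈ 𝓤` is not of the form
`7 • y`: applying the `η₁`-projector `e` gives `e x′ = (48·λ) • θ` with `λ = Σᵢ kᵢ C(tᵢ)(1+T)^{jᵢ} ∈ Λ^×` (constant term `Σ kᵢtᵢ`),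
so `x′ = 7y` would put `θ = 7 • ((48λ)⁻¹ • e y)` in `7·𝓤^{η₁}`.
* §1 `twistWeight` (`λ`), `constantCoeff_twistWeight`, `isUnit_twistWeight`; `apply_twistedSum` (`e x′ = (λ·48) • θ`).
* §2 ★ `GenusDatum.twistedSum_ne_seven_smul` — under `GenusResidueNonzeroShape dat` and `IsUnit (Σ kᵢ tᵢ)`: `x′ ≠ 7 • y` for all `y`.
In the (B2′) road (memo (m1)): `υᵢγ₀^{jᵢ}` are E1's tower lifts of the representatives of `Uₙ/Hₙ`, `kᵢ = bᵢcᵢ`, `tᵢ = χ_D(aᵢ)ω(aᵢ)⁵`,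
and `Σ kᵢtᵢ ≡ Σ ω(aᵢ)³ = [Uₙ:Hₙ] ≢ 0 (7)`; the semilocal half (f2)/L5b turns «`b″ₙ ∈ F′ₙ^{×7}` for all `n`» into `x′ = 7y` (König +
pins (S), (I), (N)), contradicting ★.
HONEST LABEL: Λ-module algebra on the frame's pins; two small `def`s (`twistWeight`, `twistedSum` — elements of `Λ` and `𝓤`, not
`Prop`s), no named fact, no instance, no sorry; nothing closes; (B2′) NOT proved; stmt-BirchSwinnertonDyer-19945 OPEN; BSD claimed for no curve.

## References
* T. Tsuji, J. Number Theory 78 (1999), §2 Lemma 2.1 (pp. 3–4), §3 Thm 3.1 (i) (p. 6). [Tsuji1999]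
* S. Lang, *Cyclotomic Fields I–II* (1990), Ch. 10 §2 Thm 2.3 (PDF p. 172). [Lang1990]
* K. Kato, Astérisque 295 (2004), §15.5–§15.6 (pp. 253–254). [Kato2004Asterisque]
* Tree: `RamifiedSevenGenusSemilocalKernel.lean` (`apply_act_one_add_X_pow_smul_of_eq`), `RamifiedSevenGenusFactorisationShape.lean`
  (`GenusDatum`, `genusResidueNonzeroShape_iff_not_exists`, `IsChiProjector.apply_mem`), `RamifiedSevenGenusUnitSide.lean` (`isUnit_fortyEight`).
-/

noncomputable section

open scoped NumberField
open PowerSeries IsDedekindDomain Field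
open Literature.NumberTheory.EllipticCurves
open Literature.NumberTheory.EllipticCurves.IwasawaAlgebra
open Literature.NumberTheory.IwasawaTheory
open Literature.NumberTheory.ComplexMultiplication.EllipticUnits
open Literature.NumberTheory.NumberFields
open Literature.NumberTheory.GaloisRepresentations

namespace Summit.BirchSwinnertonDyer.Rank1Residual.Additive.GenusSeven

/-! ## §1 The weight `λ = Σᵢ kᵢ C(η₁ υᵢ)(1+T)^{jᵢ} ∈ Λ` and the twisted sum `x′ ∈ 𝓤` -/

namespace GenusFrame

variable (F : GenusFrame) {ι : Type} [Fintype ι] (υ : ι → torsionCyclotomicSubgroup 7) (j k : ι → ℕ)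

/-- **The twist weight `λ = Σᵢ kᵢ · C(η₁(υᵢ)) · (1+T)^{jᵢ} ∈ Λ`** — the `η₁`-reading of the operator `Σᵢ kᵢ υᵢ γ₀^{jᵢ}`.
[cite: Tsuji1999, §2 Lemma 2.1 (pp. 3–4, «e_χ·g = χ(g)e_χ»)] -/
def twistWeight : IwasawaAlgebra 7 :=
  ∑ i, (k i : IwasawaAlgebra 7) * (C ((F.η₁ (υ i) : ℤ_[7]ˣ) : ℤ_[7]) * (1 + X : IwasawaAlgebra 7) ^ (j i))

/-- Unfolding `twistWeight`. [cite: Tsuji1999, §2 Lemma 2.1 (pp. 3–4)] -/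
theorem twistWeight_def : F.twistWeight υ j k =
    ∑ i, (k i : IwasawaAlgebra 7) * (C ((F.η₁ (υ i) : ℤ_[7]ˣ) : ℤ_[7]) * (1 + X : IwasawaAlgebra 7) ^ (j i)) := rfl

/-- **The constant term of `λ` is the character-weight `Σᵢ kᵢ η₁(υᵢ)`** (`(1+T)^j` has constant term `1`).
[cite: Tsuji1999, §2 Lemma 2.1 (pp. 3–4)] -/
theorem constantCoeff_twistWeight :
    constantCoeff (F.twistWeight υ j k) = ∑ i, (k i : ℤ_[7]) * ((F.η₁ (υ i) : ℤ_[7]ˣ) : ℤ_[7]) := by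
  rw [twistWeight_def, map_sum]
  refine Finset.sum_congr rfl fun i _ ↦ ?_
  rw [map_mul, map_mul, map_pow, map_add, map_one, constantCoeff_X, add_zero, one_pow, mul_one, map_natCast,
    constantCoeff_C]

/-- **`λ ∈ Λ^×` as soon as the character-weight is a unit of `ℤ₇`.** [cite: Lang1990, Ch. 10 §2 Thm 2.3 (PDF p. 172)] -/
theorem isUnit_twistWeight (hunit : IsUnit (∑ i, (k i : ℤ_[7]) * ((F.η₁ (υ i) : ℤ_[7]ˣ) : ℤ_[7]))) :
    IsUnit (F.twistWeight υ j k) := by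
  rw [PowerSeries.isUnit_iff_constantCoeff, constantCoeff_twistWeight]
  exact hunit

end GenusFrame

namespace GenusDatum

variable {F : GenusFrame} {θu : ∀ n : ℕ, globalUnitsOf (F.layer n)} (d : GenusDatum F θu)
  {ι : Type} [Fintype ι] (υ : ι → torsionCyclotomicSubgroup 7) (j k : ι → ℕ)

/-- **The twisted sum `x′ = Σᵢ kᵢ • υᵢ·((1+T)^{jᵢ} • (48 • θraw)) ∈ 𝓤`** (the element whose level-`n` projection is the 48-th power of the
twisted norm `∏ᵢ (σᵢ θ_n)^{kᵢ}` of the elliptic family, `rep_act_one_add_X_pow_smul_eq_of_agree`).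
[cite: Kato2004Asterisque, §15.5–§15.6 (pp. 253–254)] [cite: Tsuji1999, §3 (pp. 5–6)] -/
def twistedSum : F.U.M :=
  ∑ i, k i • F.U.act (υ i) ((1 + X : IwasawaAlgebra 7) ^ (j i) • (48 • d.θraw))

/-- Unfolding `twistedSum`. [cite: Tsuji1999, §3 (pp. 5–6)] -/
theorem twistedSum_def : d.twistedSum υ j k = ∑ i, k i • F.U.act (υ i) ((1 + X : IwasawaAlgebra 7) ^ (j i) • (48 • d.θraw)) := rfl

/-- **`e x′ = (λ · 48) • θ`** — the `η₁`-projector reads the twisted sum on the `η₁`-line. [cite: Tsuji1999, §2 Lemma 2.1 (pp. 3–4)] -/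
theorem apply_twistedSum :
    d.e (d.twistedSum υ j k) = (F.twistWeight υ j k * (48 : IwasawaAlgebra 7)) • (d.θ : F.U.M) := by
  rw [twistedSum_def, map_sum, GenusFrame.twistWeight_def, Finset.sum_mul, Finset.sum_smul]
  refine Finset.sum_congr rfl fun i _ ↦ ?_
  rw [map_nsmul, F.apply_act_one_add_X_pow_smul_of_eq d.e_isChiProjector rfl, map_nsmul, d.θ_eq, smul_comm,
    ← Nat.cast_smul_eq_nsmul (IwasawaAlgebra 7) (k i), ← Nat.cast_smul_eq_nsmul (IwasawaAlgebra 7) 48, smul_smul, smul_smul]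
  congr 1
  push_cast
  ring

/-! ## §2 ★ The twisted sum is not divisible by `7` -/

/-- ★ **The Λ-side of the genus residue.**  If `GenusResidueNonzeroShape dat` (`e_{η₁}θ^𝔞 ∉ 7·𝓤^{η₁}`) and the character-weight
`Σᵢ kᵢ η₁(υᵢ)` is a unit of `ℤ₇`, then the twisted sum `x′` is not `7 • y` for any `y ∈ 𝓤` (else `θ = 7 • ((48λ)⁻¹ • e y)`).
[cite: Tsuji1999, Thm 3.1 (i) (p. 6)] [cite: Lang1990, Ch. 10 §2 Thm 2.3 (PDF p. 172)] -/
theorem twistedSum_ne_seven_smul (hres : GenusResidueNonzeroShape d)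
    (hunit : IsUnit (∑ i, (k i : ℤ_[7]) * ((F.η₁ (υ i) : ℤ_[7]ˣ) : ℤ_[7]))) (y : F.U.M) :
    d.twistedSum υ j k ≠ 7 • y := by
  intro hy
  obtain ⟨w, hw⟩ := (F.isUnit_twistWeight υ j k hunit).mul ((GenusFrame.isUnit_fortyEight.map (C : ℤ_[7] →+* IwasawaAlgebra 7)))
  have hw' : (w : IwasawaAlgebra 7) = F.twistWeight υ j k * (48 : IwasawaAlgebra 7) := by
    rw [hw, map_natCast]; norm_cast
  -- `e x′ = (48λ) • θ = 7 • e y`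
  have h1 : (w : IwasawaAlgebra 7) • (d.θ : F.U.M) = 7 • d.e y := by
    rw [hw', ← apply_twistedSum, hy, map_nsmul]
  -- divide by the unit `w`; `e y ∈ 𝓤^{η₁}`
  have hey : d.e y ∈ F.U.chiPart F.η₁ := d.e_isChiProjector.apply_mem y
  have h7 : (C (7 : ℤ_[7]) : IwasawaAlgebra 7) = ((7 : ℕ) : IwasawaAlgebra 7) := by
    rw [← map_natCast (C : ℤ_[7] →+* IwasawaAlgebra 7) 7]; norm_cast
  have h2 : (d.θ : F.U.M) = (C (7 : ℤ_[7]) : IwasawaAlgebra 7) • ((↑w⁻¹ : IwasawaAlgebra 7) • d.e y) := by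
    rw [smul_smul, mul_comm, ← smul_smul, h7, Nat.cast_smul_eq_nsmul, ← h1, smul_smul, Units.inv_mul, one_smul]
  refine (genusResidueNonzeroShape_iff_not_exists d).mp hres ⟨⟨(↑w⁻¹ : IwasawaAlgebra 7) • d.e y, ?_⟩, Subtype.ext ?_⟩
  · exact (F.U.chiPart F.η₁).smul_mem _ hey
  · rw [Submodule.coe_smul]
    exact h2

end GenusDatum

end Summit.BirchSwinnertonDyer.Rank1Residual.Additive.GenusSeven

end
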